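import Summits.BirchSwinnertonDyer.BirchSwinnertonDyer.Theses.AdditiveKolyvaginRoad
import Summits.BirchSwinnertonDyer.BirchSwinnertonDyer.Theorems.EdixhovenFibreFiveSevenManinConstantDividesDegree
import HarnessLib

/-!
# Route `AdditiveKolyvaginRoad`, support item `CesnaviciusNeururerSahaManinDegree` (stmt-BirchSwinnertonDyer-20481 = ČNS Thm. 1.2 as
# typed, BY NAME) ⟸ MODULARITY — conditional closer by name; the binder `hC` of `closes` carries no weight beyond `hP`

Cell `pub/bsd-wall`, seat `bsd-line-edix-p1` g43 (route EdixhovenFibreFiveSeven; the item is AKR's by-name form of the seventh conjunct of EF57's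
`PublishedManinFacts`), `--supports stmt-BirchSwinnertonDyer-20481`.  The item's signature IS the Literature fact
`cesnaviciusNeururerSaha_padicVal_maninConstant_le_modularDegree` (for every globally minimal `W`, EVERY conductor-level datum and every prime off
two clauses, `v_p(c) ≤ v_p(deg φ)`).  By `EdixhovenFibreFiveSevenManinConstantDividesDegree` (p829622) it holds at every ODD prime unconditionally and
at `p = 2` modulo the Modularity theorem `exists_isNewformOf` (sixth conjunct of the route's own binder `hP : PublishedInputsAdditiveKoly`):

* `cesnaviciusNeururerSahaManinDegree_of_modularity : exists_isNewformOf → CesnaviciusNeururerSahaManinDegree`,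
* `cesnaviciusNeururerSahaManinDegree_of_publishedInputs : PublishedInputsAdditiveKoly → CesnaviciusNeururerSahaManinDegree`
  (planner datum: `hC := … hP` in `Theses.AdditiveKolyvaginRoad.closes`).

HONEST STATUS.  CONDITIONAL on modularity as typed; UDC-dependent; the item stays OPEN as filed (its `p = 2` clause is asserted outright).
BSD is proved for no curve. [cite: CesnaviciusNeururerSaha2023, Thm. 1.2] [cite: BCDTJAMS2001, Thm. A]
-/

set_option autoImplicit false
-- the Theorems namespace of this sub repeats the summit name by design (D-0017 nested layout)
set_option linter.dupNamespace false

namespace Summit.BirchSwinnertonDyer.BirchSwinnertonDyer.Theorems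

open Literature.NumberTheory.EllipticCurves Literature.NumberTheory.EllipticCurves.ModularForms

/-- **AKR item 20481 `CesnaviciusNeururerSahaManinDegree` ⟸ modularity** (odd primes unconditional, `p = 2` via the half-index exclusion at
the optimal curve, which needs level = conductor).  CONDITIONAL; the item stays open as filed. [cite: CesnaviciusNeururerSaha2023, Thm. 1.2]
[cite: BCDTJAMS2001, Thm. A] -/
theorem AdditiveKolyvaginRoad.cesnaviciusNeururerSahaManinDegree_of_modularity (hnf : exists_isNewformOf) :
    Summit.BirchSwinnertonDyer.BirchSwinnertonDyer.Theses.AdditiveKolyvaginRoad.CesnaviciusNeururerSahaManinDegree :=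
  cesnaviciusNeururerSaha_padicVal_maninConstant_le_modularDegree_of_modularity hnf

/-- **AKR: `hC` from `hP`** — item 20481 from the route's bundle `PublishedInputsAdditiveKoly` (stmt-20137; sixth conjunct = modularity).
Planner datum for `Theses.AdditiveKolyvaginRoad.closes`.  CONDITIONAL (hypothesis bundle). [cite: BCDTJAMS2001, Thm. A] -/
theorem AdditiveKolyvaginRoad.cesnaviciusNeururerSahaManinDegree_of_publishedInputs
    (hP : Summit.BirchSwinnertonDyer.BirchSwinnertonDyer.Theses.AdditiveKolyvaginRoad.PublishedInputsAdditiveKoly) :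
    Summit.BirchSwinnertonDyer.BirchSwinnertonDyer.Theses.AdditiveKolyvaginRoad.CesnaviciusNeururerSahaManinDegree :=
  AdditiveKolyvaginRoad.cesnaviciusNeururerSahaManinDegree_of_modularity hP.2.2.2.2.2.1

end Summit.BirchSwinnertonDyer.BirchSwinnertonDyer.Theorems
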